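import Literature.AlgebraicGeometry.HodgeTheory.MotivatedGaloisGroup
import Literature.AlgebraicGeometry.HodgeTheory.RealStructureSingular
import Literature.AlgebraicGeometry.HodgeTheory.ClassesSupportedOnComplexification
import Literature.AlgebraicTopology.SingularHomology.CohomologyRingChange
import HarnessLib

/-!
# Ring 2 transport — the action of `Aut(ℂ)` on `H^*(X(ℂ); ℂ) = H^*(X(ℂ); ℚ) ⊗ ℂ` and on the
Hodge group (junction `DeligneMilne1982_Thm_6_20_full → HodgeGroupH1CommutantSpan`, part B of 3)

research route conditional on HC_CM; not a corollary; Q11.4-sentence-2 already refuted in dim ≥ 3.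

Cell `pub-hodge-ring2`, seat `transport`, gen 52; helper file riding `--supports` the umbrella
`Theses.RankFourFaces.CMToAbelian` (LEAD ruling L41.7 (1)). For a field automorphism `σ` of `ℂ` the
coefficient change `θ_σ = σ_* : Hᵏ(Y; ℂ) → Hᵏ(Y; ℂ)` (the tree's `coeffClass` along `σ`, Hatcher §3.1) is
the action of `σ` on the second factor of `Hᵏ(Y; ℚ) ⊗_ℚ ℂ`. This is Deligne's «`σμ` for
`σ ∈ Aut(ℂ)`» (LNM 900, I §3, proof of Prop. 3.4: the subspace fixed by `G` is stable under all `σμ`,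
hence defined over `ℚ`) on the tree's Tannaka-free carriers: we prove that `θ_σ` is `σ`-semilinear,
natural, multiplicative and the identity on rational classes, and deduce that **the Hodge group
`hodgeGroup n X ⊆ ∏ₖ GL(Hᵏ(X(ℂ); ℂ))` is stable under `g ↦ θ_σ ∘ g ∘ θ_σ⁻¹`** (its defining tensors,
the rational `(p,p)`-classes on the powers of `X`, are rational, and Künneth families conjugate to
Künneth families).

WHAT IS PROVED (theorems only: no `sorry`, no new axiom, no named fact, no `def`). Notation in the
docstrings: `θ_σ := coeffClass (σ : ℂ →+* ℂ).toAddMonoidHom k`.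
* §B1 `θ_σ θ_{σ⁻¹} = id`, `θ_σ (z • c) = σ z • θ_σ c`, `θ_σ f^* = f^* θ_σ`, `θ_σ (a ⌣ b) = θ_σ a ⌣ θ_σ b`,
  `θ_σ` fixes `ofRatClass` and every `IsRationalClass`;
* §B2 in the `ℂ`-basis `eᵢ = bᵢ ⊗ 1` of `Hᵏ(X(ℂ); ℂ)` coming from a `ℚ`-basis `b` of `Hᵏ(X(ℂ); ℚ)`,
  the coordinates of `θ_σ v` are `σ` of the coordinates of `v`;
* §B3 for `g ∈ hodgeGroup n X` there is `g^σ ∈ hodgeGroup n X` with `g^σ_k = θ_σ g_k θ_σ⁻¹`.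

References: P. Deligne, *Hodge cycles on abelian varieties*, LNM 900 (1982), I §3 proof of Prop. 3.4
[Deligne1982HodgeCycles]; A. Hatcher, *Algebraic Topology* (2002), §3.1 p. 198, §3.2 p. 215 [HatcherAT2002].
-/

set_option linter.dupNamespace false

noncomputable section

open CategoryTheory MonoidalCategory CartesianMonoidalCategory
open Literature.AlgebraicTopology.SingularHomology
open Literature.AlgebraicTopology.SingularHomology.singularCochainComplex
open Literature.AlgebraicGeometry Literature.AlgebraicGeometry.Motives
open Literature.AlgebraicGeometry.HodgeTheory
open scoped TensorProduct

namespace Summit.HodgeConjecture.HodgeConjecture.Ring2Transport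

universe u

/-! ## §B1 The coefficient change `θ_σ` along a field automorphism `σ` of `ℂ` -/

section Theta

variable {Y : Type u} [TopologicalSpace Y]

/-- Change of coefficient RING `f_*` (tree `singularCohomology.ringChange`, multiplicative) agrees with
change of coefficient GROUP along `f` (tree `coeffClass`): both are `[u] ↦ [f ∘ u]`. [cite: HatcherAT2002, §3.1 p. 198] -/
theorem ringChange_eq_coeffClass {R S : Type} [CommRing R] [CommRing S] (f : R →+* S) (k : ℕ)
    (c : singularCohomology R R Y k) :
    singularCohomology.ringChange f Y k c = coeffClass (R := R) (S := S) f.toAddMonoidHom k c := by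
  induction c using singularCohomology_induction_on with
  | h u =>
    rw [singularCohomology.ringChange_π, coeffClass_π]
    rfl

/-- `θ_σ ∘ θ_{σ⁻¹} = id`. [folklore] -/
theorem coeffClass_ringEquiv_apply_symm (σ : ℂ ≃+* ℂ) (k : ℕ) (c : singularCohomology ℂ ℂ Y k) :
    coeffClass (R := ℂ) (S := ℂ) (σ : ℂ →+* ℂ).toAddMonoidHom k
      (coeffClass (R := ℂ) (S := ℂ) (σ.symm : ℂ →+* ℂ).toAddMonoidHom k c) = c := by
  rw [← coeffClass_comp]
  rw [coeffClass_congr (g' := AddMonoidHom.id ℂ) (fun a => by simp) c, coeffClass_id]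

/-- `θ_{σ⁻¹} ∘ θ_σ = id`. [folklore] -/
theorem coeffClass_ringEquiv_symm_apply (σ : ℂ ≃+* ℂ) (k : ℕ) (c : singularCohomology ℂ ℂ Y k) :
    coeffClass (R := ℂ) (S := ℂ) (σ.symm : ℂ →+* ℂ).toAddMonoidHom k
      (coeffClass (R := ℂ) (S := ℂ) (σ : ℂ →+* ℂ).toAddMonoidHom k c) = c := by
  rw [← coeffClass_comp]
  rw [coeffClass_congr (g' := AddMonoidHom.id ℂ) (fun a => by simp) c, coeffClass_id]

/-- **`θ_σ` is `σ`-semilinear**: `θ_σ (z • c) = σ(z) • θ_σ c`. [cite: Deligne1982HodgeCycles, I §3 proof of Prop. 3.4] -/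
theorem coeffClass_ringEquiv_smul (σ : ℂ ≃+* ℂ) (k : ℕ) (z : ℂ) (c : singularCohomology ℂ ℂ Y k) :
    coeffClass (R := ℂ) (S := ℂ) (σ : ℂ →+* ℂ).toAddMonoidHom k (z • c) =
      σ z • coeffClass (R := ℂ) (S := ℂ) (σ : ℂ →+* ℂ).toAddMonoidHom k c := by
  rw [coeffClass_smul, smul_coeffClass]
  exact coeffClass_congr (fun a => by simp [map_mul]) c

/-- **`θ_σ` is natural**: `θ_σ (f^* c) = f^* (θ_σ c)`. [cite: HatcherAT2002, §3.1 p. 198] -/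
theorem coeffClass_ringEquiv_map (σ : ℂ ≃+* ℂ) {Y' : Type u} [TopologicalSpace Y'] (f : C(Y', Y))
    (k : ℕ) (c : singularCohomology ℂ ℂ Y k) :
    coeffClass (R := ℂ) (S := ℂ) (σ : ℂ →+* ℂ).toAddMonoidHom k (singularCohomology.map ℂ ℂ f k c) =
      singularCohomology.map ℂ ℂ f k (coeffClass (R := ℂ) (S := ℂ) (σ : ℂ →+* ℂ).toAddMonoidHom k c) :=
  coeffClass_map _ f c

/-- **`θ_σ` is multiplicative**: `θ_σ (a ⌣ b) = θ_σ a ⌣ θ_σ b`. [cite: HatcherAT2002, §3.2 p. 215] -/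
theorem coeffClass_ringEquiv_cupProduct (σ : ℂ ≃+* ℂ) {p q k : ℕ} (h : p + q = k)
    (a : singularCohomology ℂ ℂ Y p) (b : singularCohomology ℂ ℂ Y q) :
    coeffClass (R := ℂ) (S := ℂ) (σ : ℂ →+* ℂ).toAddMonoidHom k (cupProduct h a b) =
      cupProduct h (coeffClass (R := ℂ) (S := ℂ) (σ : ℂ →+* ℂ).toAddMonoidHom p a)
        (coeffClass (R := ℂ) (S := ℂ) (σ : ℂ →+* ℂ).toAddMonoidHom q b) := by
  rw [← ringChange_eq_coeffClass, ← ringChange_eq_coeffClass, ← ringChange_eq_coeffClass]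
  exact singularCohomology.ringChange_cupProduct (σ : ℂ →+* ℂ) h a b

/-- **`θ_σ` fixes rational classes**: `θ_σ (a ⊗ 1) = a ⊗ 1`. [cite: Deligne1982HodgeCycles, I §3 proof of Prop. 3.4] -/
theorem coeffClass_ringEquiv_ofRatClass (σ : ℂ ≃+* ℂ) (k : ℕ) (a : singularCohomology ℚ ℚ Y k) :
    coeffClass (R := ℂ) (S := ℂ) (σ : ℂ →+* ℂ).toAddMonoidHom k (ofRatClass Y k a) = ofRatClass Y k a := by
  unfold ofRatClass
  rw [← coeffClass_comp]
  exact coeffClass_congr (fun q => by simp) a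

/-- `θ_σ c = c` for every rational class `c`. [cite: Deligne1982HodgeCycles, I §3 proof of Prop. 3.4] -/
theorem coeffClass_ringEquiv_of_isRationalClass (σ : ℂ ≃+* ℂ) {k : ℕ} {c : singularCohomology ℂ ℂ Y k}
    (hc : IsRationalClass c) :
    coeffClass (R := ℂ) (S := ℂ) (σ : ℂ →+* ℂ).toAddMonoidHom k c = c := by
  obtain ⟨a, rfl⟩ := (isRationalClass_iff_mem_range_ofRatClass c).1 hc
  exact coeffClass_ringEquiv_ofRatClass σ k a

/-- **Conjugate of a linear automorphism.** For `e ∈ GL(Hᵏ(Y; ℂ))` the map `θ_σ ∘ e ∘ θ_σ⁻¹` is again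
`ℂ`-linear (two `σ`-semilinear twists cancel) and invertible; we record it as an element `e^σ` of
`GL(Hᵏ(Y; ℂ))` together with the formulas for `e^σ` and for `e` in terms of `e^σ`. [cite: Deligne1982HodgeCycles, I §3 proof of Prop. 3.4] -/
theorem exists_linearEquiv_conj (σ : ℂ ≃+* ℂ) (k : ℕ)
    (e : singularCohomology ℂ ℂ Y k ≃ₗ[ℂ] singularCohomology ℂ ℂ Y k) :
    ∃ e' : singularCohomology ℂ ℂ Y k ≃ₗ[ℂ] singularCohomology ℂ ℂ Y k,
      (∀ c, e' c = coeffClass (R := ℂ) (S := ℂ) (σ : ℂ →+* ℂ).toAddMonoidHom k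
        (e (coeffClass (R := ℂ) (S := ℂ) (σ.symm : ℂ →+* ℂ).toAddMonoidHom k c))) ∧
      (∀ c, e c = coeffClass (R := ℂ) (S := ℂ) (σ.symm : ℂ →+* ℂ).toAddMonoidHom k
        (e' (coeffClass (R := ℂ) (S := ℂ) (σ : ℂ →+* ℂ).toAddMonoidHom k c))) := by
  refine ⟨{ toFun := fun c => coeffClass (R := ℂ) (S := ℂ) (σ : ℂ →+* ℂ).toAddMonoidHom k
              (e (coeffClass (R := ℂ) (S := ℂ) (σ.symm : ℂ →+* ℂ).toAddMonoidHom k c))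
            invFun := fun c => coeffClass (R := ℂ) (S := ℂ) (σ : ℂ →+* ℂ).toAddMonoidHom k
              (e.symm (coeffClass (R := ℂ) (S := ℂ) (σ.symm : ℂ →+* ℂ).toAddMonoidHom k c))
            map_add' := fun c c' => by simp only [map_add]
            map_smul' := fun z c => by
              rw [RingHom.id_apply, coeffClass_ringEquiv_smul, map_smul, coeffClass_ringEquiv_smul]
              congr 1
              exact σ.apply_symm_apply z
            left_inv := fun c => by
              simp only [coeffClass_ringEquiv_symm_apply, LinearEquiv.symm_apply_apply,
                coeffClass_ringEquiv_apply_symm]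
            right_inv := fun c => by
              simp only [coeffClass_ringEquiv_symm_apply, LinearEquiv.apply_symm_apply,
                coeffClass_ringEquiv_apply_symm] }, fun c => rfl, fun c => ?_⟩
  change e c = coeffClass (R := ℂ) (S := ℂ) (σ.symm : ℂ →+* ℂ).toAddMonoidHom k
    (coeffClass (R := ℂ) (S := ℂ) (σ : ℂ →+* ℂ).toAddMonoidHom k
      (e (coeffClass (R := ℂ) (S := ℂ) (σ.symm : ℂ →+* ℂ).toAddMonoidHom k
        (coeffClass (R := ℂ) (S := ℂ) (σ : ℂ →+* ℂ).toAddMonoidHom k c))))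
  rw [coeffClass_ringEquiv_symm_apply, coeffClass_ringEquiv_symm_apply]

end Theta

/-! ## §B2 Coordinates: `θ_σ` acts on `H = H_ℚ ⊗ ℂ` through the second factor -/

section Coordinates

variable {n : ℕ} {X : SchemeOver ℂ} {ι : Type*}

/-- In the `ℂ`-basis `e = (bᵢ ⊗ 1)` of `Hᵏ(X(ℂ); ℂ) ≅ Hᵏ(X(ℂ); ℚ) ⊗ ℂ` (`ofRatClassBaseChangeEquiv`) built
from a `ℚ`-basis `b` of `Hᵏ(X(ℂ); ℚ)`, the basis vectors are the rational classes `bᵢ ⊗ 1`. [folklore] -/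
theorem basis_map_ofRatClassBaseChangeEquiv_apply (hX : IsSmoothProjective n X) (k : ℕ)
    (b : Module.Basis ι ℚ (bettiCohomology X k)) (i : ι) :
    (Algebra.TensorProduct.basis ℂ b).map (ofRatClassBaseChangeEquiv hX k) i =
      ofRatClass (ComplexPoints X) k (b i) := by
  rw [Module.Basis.map_apply, Algebra.TensorProduct.basis_apply, ofRatClassBaseChangeEquiv_apply,
    ofRatClassBaseChange_tmul, one_smul]

/-- **`θ_σ = 1 ⊗ σ` in coordinates**: the coordinates of `θ_σ v` in the basis `(bᵢ ⊗ 1)` are `σ` applied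
to the coordinates of `v`. [cite: Deligne1982HodgeCycles, I §3 proof of Prop. 3.4] -/
theorem basis_repr_coeffClass_ringEquiv [Fintype ι] (hX : IsSmoothProjective n X) (k : ℕ)
    (b : Module.Basis ι ℚ (bettiCohomology X k)) (σ : ℂ ≃+* ℂ) (v : complexBetti X k) (i : ι) :
    ((Algebra.TensorProduct.basis ℂ b).map (ofRatClassBaseChangeEquiv hX k)).repr
        (coeffClass (R := ℂ) (S := ℂ) (σ : ℂ →+* ℂ).toAddMonoidHom k v) i =
      σ (((Algebra.TensorProduct.basis ℂ b).map (ofRatClassBaseChangeEquiv hX k)).repr v i) := by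
  classical
  set e := (Algebra.TensorProduct.basis ℂ b).map (ofRatClassBaseChangeEquiv hX k) with he
  conv_lhs => rw [← e.sum_repr v]
  rw [map_sum]
  simp_rw [coeffClass_ringEquiv_smul]
  have hfix : ∀ j, coeffClass (R := ℂ) (S := ℂ) (σ : ℂ →+* ℂ).toAddMonoidHom k (e j) = e j := fun j => by
    rw [he, basis_map_ofRatClassBaseChangeEquiv_apply, coeffClass_ringEquiv_ofRatClass]
  simp_rw [hfix]
  rw [e.repr_sum_self]

end Coordinates

/-! ## §B3 `hodgeGroup n X` is stable under conjugation by `θ_σ` -/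

section HodgeGroup

variable {n : ℕ} {X : SchemeOver ℂ}

/-- **The Hodge group is `Aut(ℂ)`-stable** (Deligne I §3, proof of Prop. 3.4, on the tree's Tannaka-free
carriers). For `σ ∈ Aut(ℂ)` and `g ∈ Hg(X)(ℂ) = hodgeGroup n X` the conjugate `g^σ = (θ_σ g_k θ_σ⁻¹)_k`
lies in `hodgeGroup n X`: the Künneth family of `g` conjugates to a Künneth family of `g^σ` (`θ_σ` is
natural and multiplicative), and it fixes every rational `(p,p)`-class of every power because `θ_σ^{±1}`
does (`θ_σ` is the identity on rational classes). The second clause expresses `g` through `g^σ`.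
[cite: Deligne1982HodgeCycles, I §3 proof of Prop. 3.4] -/
theorem exists_conj_mem_hodgeGroup (σ : ℂ ≃+* ℂ) {g : ∀ k, complexBetti X k ≃ₗ[ℂ] complexBetti X k}
    (hg : g ∈ hodgeGroup n X) :
    ∃ g' : ∀ k, complexBetti X k ≃ₗ[ℂ] complexBetti X k, g' ∈ hodgeGroup n X ∧
      (∀ k c, g' k c = coeffClass (R := ℂ) (S := ℂ) (σ : ℂ →+* ℂ).toAddMonoidHom k
        (g k (coeffClass (R := ℂ) (S := ℂ) (σ.symm : ℂ →+* ℂ).toAddMonoidHom k c))) ∧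
      (∀ k c, g k c = coeffClass (R := ℂ) (S := ℂ) (σ.symm : ℂ →+* ℂ).toAddMonoidHom k
        (g' k (coeffClass (R := ℂ) (S := ℂ) (σ : ℂ →+* ℂ).toAddMonoidHom k c))) := by
  obtain ⟨G, hG, h0, hGfix⟩ := hg
  subst h0
  choose G' hG' hG'inv using fun a k => exists_linearEquiv_conj (Y := ComplexPoints (cartesianPow X (a + 1))) σ k (G a k)
  refine ⟨G' 0, ⟨G', ⟨fun a i j k h x y => ?_⟩, rfl, fun a p x hx => ?_⟩, hG' 0, hG'inv 0⟩
  · -- Künneth compatibility of the conjugated family (all spaces written as `X^{×(a+1)} ⊗ X`)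
    have e1 : ∀ c, G' (a + 1) k c =
        coeffClass (Y := ComplexPoints (cartesianPow X (a + 1) ⊗ X)) (R := ℂ) (S := ℂ)
          (σ : ℂ →+* ℂ).toAddMonoidHom k (G (a + 1) k
            (coeffClass (Y := ComplexPoints (cartesianPow X (a + 1) ⊗ X)) (R := ℂ) (S := ℂ)
              (σ.symm : ℂ →+* ℂ).toAddMonoidHom k c)) := hG' (a + 1) k
    have e0 : ∀ c : complexBetti X j, G' 0 j c =
        coeffClass (Y := ComplexPoints X) (R := ℂ) (S := ℂ) (σ : ℂ →+* ℂ).toAddMonoidHom j (G 0 j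
          (coeffClass (Y := ComplexPoints X) (R := ℂ) (S := ℂ) (σ.symm : ℂ →+* ℂ).toAddMonoidHom j c)) :=
      hG' 0 j
    rw [e1, hG' a i, e0]
    have hA := coeffClass_ringEquiv_cupProduct (Y := ComplexPoints (cartesianPow X (a + 1) ⊗ X)) σ.symm h
      (complexBetti.map (fst (cartesianPow X (a + 1)) X) i x)
      (complexBetti.map (snd (cartesianPow X (a + 1)) X) j y)
    rw [coeffClass_ringEquiv_map, coeffClass_ringEquiv_map] at hA
    have hC := coeffClass_ringEquiv_cupProduct (Y := ComplexPoints (cartesianPow X (a + 1) ⊗ X)) σ h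
      (complexBetti.map (fst (cartesianPow X (a + 1)) X) i
        (G a i (coeffClass (R := ℂ) (S := ℂ) (σ.symm : ℂ →+* ℂ).toAddMonoidHom i x)))
      (complexBetti.map (snd (cartesianPow X (a + 1)) X) j
        (G 0 j (coeffClass (Y := ComplexPoints X) (R := ℂ) (S := ℂ) (σ.symm : ℂ →+* ℂ).toAddMonoidHom j y)))
    rw [coeffClass_ringEquiv_map, coeffClass_ringEquiv_map] at hC
    rw [hA, hG.map_cross a i j k h]
    exact hC
  · -- the conjugated family fixes the rational `(p,p)`-classes
    rw [hG', coeffClass_ringEquiv_of_isRationalClass σ.symm hx.1, hGfix a p x hx,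
      coeffClass_ringEquiv_of_isRationalClass σ hx.1]

end HodgeGroup

end Summit.HodgeConjecture.HodgeConjecture.Ring2Transport

end
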